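import Literature.AnabelianGeometry.SemiGraphs.TemperedHbddOfNoHostableCore
import Literature.AnabelianGeometry.SemiGraphs.TemperedMaximalCompact
import HarnessLib

/-!
# [SemiAnbd] Cor 3.9 (R3c) `EdgeLikeCentralizerAt` when every open edge piece has FINITELY MANY HOSTABLE
# EDGES — and the FINITE-QUOTIENT SEPARATION test for hostability (proof-only)

Mochizuki, *Semi-graphs of anabelioids*, Publ. RIMS **42** (2006), §3, Corollary 3.9, proof p. 43 l. 13
("[again by Theorem 3.7, (iii), (iv)]" — the cell's step (R3c), FACT-LIST rows F-2772
`EdgeLikeCentralizerAt` / F-2773 `EdgeLikeCentralizer`) [cite: MochizukiSemiAnbd2006, Cor 3.9 p.43].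

PROOF-ONLY (cell abc-iut, block F, seat abc-iut-f-176 gen 6; row «FINITE-QUOTIENT SEPARATION»; no definition, no
named fact).  An edge `e′` is *hostable* for a subgroup `C` of `π₁^temp(H)` (chart `c`) when some edge-like
subgroup at `e′` contains `C` (abc-iut-f-176 gen 4, `TemperedHbddOfNoHostableCore`).
* `centralizer_le_verticial_of_finite_hostable` / `edgeLikeCentralizerAt_of_finite_hostable` /
  `edgeLikeCentralizer_of_finite_hostable` — **(R3c) at EVERY chart of every Cor-3.9 graph in which every open edge
  piece `ψ(U)` has only FINITELY MANY hostable edges** (any underlying graph, any edge groups): finitely many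
  hostable edges carry finitely many branches, so the hostable edges form no core and gen 4's
  `centralizer_le_verticial_of_noHostableCore` applies with ANY vertex of ANY vertex set as the witness.
* `exists_conj_map_le_of_le_of_mem_edgeLikeSubgroups` — **hostable ⇒ conjugate in EVERY quotient**: if `C ≤ L` with
  `L` edge-like at `e′`, then for every homomorphism `ρ : π₁^temp(H) → F` and every edge-like `L₀` at `e′`, `ρ(C)` is
  `F`-conjugate into `ρ(L₀)` (edge-like subgroups at one edge form one conjugacy class,
  `exists_conj_of_mem_edgeLikeSubgroups`).  Contrapositive `not_exists_edgeLike_ge_of_separated`: ONE quotient (a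
  Galois level of the canonical tower, a finite permutation representation, …) in which `ρ(C)` is conjugate into NO
  conjugate of `ρ(L₀)` certifies that `e′` is NOT hostable — a CHECKABLE test replacing the quantifier over the
  edge-like subgroups of `π₁^temp(H)`; `not_exists_edgeLike_ge_of_character` is the abelian special case (a
  character `χ` with `χ(C) ⊄ χ(L₀)`).
* `finite_hostable_of_separated` — if all edges outside a finite set are separated from `C` by some quotient, the
  hostable edges of `C` are finite; `centralizer_le_verticial_of_separated` combines this with the first item.
* `edgeLikeCentralizerAt_of_forall_exists_open_le` — SHRINKAGE: the (R3c) conclusion for `ψ(U′)`, `U′ ≤ U` open,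
  gives it for `ψ(U)` (centralisers are antitone), so every class criterion of the lineage (locally finite p448285,
  tame p477268, noCore p482284, noHostableCore p486373, topCyclic p493572, saturated p499292, uniformHosts p502224,
  this file) need only be verified on a cofinal family of small open subgroups of each edge group;
  `edgeLikeCentralizerAt_of_finite_hostable_small` is the instance for this file's criterion.

RESIDUAL OF THE BARE ∀ F-2773 after this file, in checkable currency: a counter-model needs an edge `e` such that
EVERY open `U ≤ Π_e` has INFINITELY many edges `e′` for which `ψ(U)` is conjugate into the image of `Π_{e′}` in EVERY
finite quotient of `π₁^temp(H)` (equivalently: conjugate into the closure of `Π_{e′}` in the profinite completion),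
these edges forming a core; by total estrangement no such conjugacy is ever witnessed inside a single vertex group.
Honest framing: statements about OUR typed tempered fundamental groups; the bare ∀-closure F-2773 is NOT claimed;
cone-irrelevant beyond finite dual graphs; no side taken on [IUTchIII] Cor. 3.12; typed ≠ proved elsewhere.
-/

namespace Literature.AnabelianGeometry.SemiGraphs

namespace ProfiniteSemiGraph

open Topology

universe u

variable {ℋ : ProfiniteSemiGraph.{u}}

/-! ### Branches over finitely many edges -/

/-- Every edge has exactly two branches, so the branches lying over a FINITE set of edges form a finite set
([SemiAnbd] §1 p. 11: "each edge `e` is a set of cardinality 2"). [cite: MochizukiSemiAnbd2006, §1 p.11] -/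
theorem finite_setOf_edgeOf_mem {E : Set ℋ.graph.Edge} (hE : E.Finite) :
    {b : ℋ.graph.Branch | ℋ.graph.edgeOf b ∈ E}.Finite := by
  change (ℋ.graph.edgeOf ⁻¹' E).Finite
  refine hE.preimage' fun e _ => ?_
  obtain ⟨b₁, b₂, -, -, -, hall⟩ := ℋ.graph.two_branches e
  exact (Set.toFinite ({b₁, b₂} : Set ℋ.graph.Branch)).subset fun b hb => by
    rcases hall b hb with rfl | rfl
    · exact Or.inl rfl
    · exact Or.inr rfl

/-! ### (R3c) when the hostable edges are finite -/

/-- **Finitely many hostable edges ⇒ no hostable core.**  If the edges `e′` carrying an edge-like subgroup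
`L ⊇ C` form a finite set, then every non-empty vertex set `S` has a member (indeed: any member) with only finitely
many branches `b` whose edge is `C`-hostable and has another branch toward `S` — the hypothesis `hNC` of abc-iut-f-176
gen 4's `centralizer_le_verticial_of_noHostableCore`. [cite: MochizukiSemiAnbd2006, Thm 3.7(iii) p.41] -/
theorem noHostableCore_of_finite_hostable (c : TemperedPiChart ℋ) (C : Subgroup c.G)
    (hfin : {e' : ℋ.graph.Edge | ∃ L ∈ edgeLikeSubgroups c e', C ≤ L}.Finite) :
    ∀ S : Set ℋ.graph.Vertex, S.Nonempty → ∃ w ∈ S,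
      {b : ℋ.graph.Branch | ℋ.graph.abuts b = some w ∧ (∃ L ∈ edgeLikeSubgroups c (ℋ.graph.edgeOf b), C ≤ L) ∧
        ∃ b', b' ≠ b ∧ ℋ.graph.edgeOf b' = ℋ.graph.edgeOf b ∧ ∃ w' ∈ S, ℋ.graph.abuts b' = some w'}.Finite := by
  intro S hS
  obtain ⟨w, hw⟩ := hS
  exact ⟨w, hw, (finite_setOf_edgeOf_mem hfin).subset fun b hb => hb.2.1⟩

/-- **The centraliser of a nontrivial compact `C` lies in each verticial host of `C`, at EVERY chart, whenever
`C` has only FINITELY MANY hostable edges** (Thm-3.7 hypotheses; any underlying graph, any edge groups): by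
`noHostableCore_of_finite_hostable` and abc-iut-f-176 gen 4's `centralizer_le_verticial_of_noHostableCore`.
[cite: MochizukiSemiAnbd2006, Thm 3.7(iii) pp.40-41] -/
theorem centralizer_le_verticial_of_finite_hostable (h37 : ℋ.Thm37Hypotheses) (c : TemperedPiChart ℋ)
    (C : Subgroup c.G) (hCc : IsCompact (C : Set c.G)) (hC : C ≠ ⊥)
    (hfin : {e' : ℋ.graph.Edge | ∃ L ∈ edgeLikeSubgroups c e', C ≤ L}.Finite)
    {v : ℋ.graph.Vertex} {H : Subgroup c.G} (hH : H ∈ verticialSubgroups c v) (hCH : C ≤ H) :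
    Subgroup.centralizer (C : Set c.G) ≤ H :=
  ℋ.centralizer_le_verticial_of_noHostableCore h37 c C hCc hC (noHostableCore_of_finite_hostable c C hfin) hH hCH

/-- **(R3c) F-2772 `EdgeLikeCentralizerAt ℋ c` at EVERY chart of every Cor-3.9 graph of anabelioids in which
every open edge piece `ψ(U)` has only FINITELY MANY hostable edges** (p. 43 l. 13 "[again by Theorem 3.7, (iii),
(iv)]"): the centraliser of `ψ(U)` lies in every verticial subgroup containing it.  No hypothesis on the underlying
graph (cores allowed) or on the edge groups. [cite: MochizukiSemiAnbd2006, Cor 3.9 p.43] -/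
theorem edgeLikeCentralizerAt_of_finite_hostable (hℋ : Cor39Hypotheses ℋ) (c : TemperedPiChart ℋ)
    (hfin : ∀ (e : ℋ.graph.Edge) (ψ : ℋ.Ge e →ₜ* c.G), IsEdgeHom c e ψ →
      ∀ (U : Subgroup (ℋ.Ge e)), IsOpen (U : Set (ℋ.Ge e)) →
      {e' : ℋ.graph.Edge | ∃ L ∈ edgeLikeSubgroups c e', U.map ψ.toMonoidHom ≤ L}.Finite) :
    EdgeLikeCentralizerAt ℋ c := by
  intro e ψ hψ U hU v H hH hUH
  obtain ⟨hCc, hC⟩ := isCompact_map_and_ne_bot_of_isEdgeHom hℋ c e ψ hψ U hU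
  exact centralizer_le_verticial_of_finite_hostable hℋ.thm37Hypotheses c _ hCc hC (hfin e ψ hψ U hU) hH hUH

/-- **F-2773 `EdgeLikeCentralizer` RESTRICTED to graphs all of whose open edge pieces have finitely many hostable
edges, hypothesis-free.**  (The bare ∀-countable fact F-2773 additionally ranges over graphs with an open edge piece
hosted over infinitely many edges, not treated here.) [cite: MochizukiSemiAnbd2006, Cor 3.9 p.43] -/
theorem edgeLikeCentralizer_of_finite_hostable :
    ∀ (ℋ : ProfiniteSemiGraph.{u}), Cor39Hypotheses ℋ → ∀ (c : TemperedPiChart ℋ),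
      (∀ (e : ℋ.graph.Edge) (ψ : ℋ.Ge e →ₜ* c.G), IsEdgeHom c e ψ →
        ∀ (U : Subgroup (ℋ.Ge e)), IsOpen (U : Set (ℋ.Ge e)) →
        {e' : ℋ.graph.Edge | ∃ L ∈ edgeLikeSubgroups c e', U.map ψ.toMonoidHom ≤ L}.Finite) →
      EdgeLikeCentralizerAt ℋ c :=
  fun _ hℋ c hfin => edgeLikeCentralizerAt_of_finite_hostable hℋ c hfin

/-! ### Hostable ⇒ conjugate in every quotient; the separation test -/

/-- **Hostable ⇒ conjugate in EVERY quotient.**  If `C ≤ L` with `L` edge-like at `e′`, then for every group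
homomorphism `ρ : π₁^temp(H) → F` and every edge-like subgroup `L₀` at `e′`, the image `ρ(C)` is `F`-conjugate into
`ρ(L₀)`: the edge-like subgroups at one edge form ONE conjugacy class ([SemiAnbd] Thm 3.7 (iii) p. 41 / Prop. 3.2,
`exists_conj_of_mem_edgeLikeSubgroups`), and homomorphisms transport conjugacy.
[cite: MochizukiSemiAnbd2006, Thm 3.7(iii) p.41] -/
theorem exists_conj_map_le_of_le_of_mem_edgeLikeSubgroups (c : TemperedPiChart ℋ) {e' : ℋ.graph.Edge}
    {C L L₀ : Subgroup c.G} (hL : L ∈ edgeLikeSubgroups c e') (hCL : C ≤ L)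
    (hL₀ : L₀ ∈ edgeLikeSubgroups c e') {F : Type*} [Group F] (ρ : c.G →* F) :
    ∃ f : F, C.map ρ ≤ (L₀.map ρ).map (MulAut.conj f).toMonoidHom := by
  obtain ⟨g, rfl⟩ := exists_conj_of_mem_edgeLikeSubgroups c hL₀ hL
  refine ⟨ρ g, ?_⟩
  rintro _ ⟨x, hx, rfl⟩
  obtain ⟨y, hy, rfl⟩ := Subgroup.mem_map.mp (hCL hx)
  refine Subgroup.mem_map.mpr ⟨ρ y, Subgroup.mem_map.mpr ⟨y, hy, rfl⟩, ?_⟩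
  simp only [MulEquiv.coe_toMonoidHom, MulAut.conj_apply, map_mul, map_inv]

/-- **The FINITE-QUOTIENT SEPARATION test (contrapositive).**  If for SOME homomorphism
`ρ : π₁^temp(H) → F` and SOME edge-like subgroup `L₀` at `e′` the image `ρ(C)` lies in NO `F`-conjugate of
`ρ(L₀)`, then NO edge-like subgroup at `e′` contains `C` — the edge `e′` is not `C`-hostable.  With `ρ` a Galois
level of the canonical tower (or any finite permutation representation) this replaces the quantifier over the
edge-like subgroups of `π₁^temp(H)` by a finite check. [cite: MochizukiSemiAnbd2006, Thm 3.7(iii) p.41] -/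
theorem not_exists_edgeLike_ge_of_separated (c : TemperedPiChart ℋ) {e' : ℋ.graph.Edge} {C L₀ : Subgroup c.G}
    (hL₀ : L₀ ∈ edgeLikeSubgroups c e') {F : Type*} [Group F] (ρ : c.G →* F)
    (hsep : ∀ f : F, ¬ C.map ρ ≤ (L₀.map ρ).map (MulAut.conj f).toMonoidHom) :
    ¬ ∃ L ∈ edgeLikeSubgroups c e', C ≤ L := by
  rintro ⟨L, hL, hCL⟩
  obtain ⟨f, hf⟩ := exists_conj_map_le_of_le_of_mem_edgeLikeSubgroups c hL hCL hL₀ ρ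
  exact hsep f hf

/-- **The separation test by a CHARACTER** (abelian target: conjugation is trivial): if `χ : π₁^temp(H) → A`, `A`
commutative, satisfies `χ(C) ⊄ χ(L₀)` for an edge-like `L₀` at `e′`, then `e′` is not `C`-hostable — the shape in
which the lineage's abelianisation arguments (the characters separating `⟨a^{p^k}⟩` from `⟨a b^{p^j}⟩‾` at the
θ-ray and the leaf-star) certify non-hostability. [cite: MochizukiSemiAnbd2006, Thm 3.7(iii) p.41] -/
theorem not_exists_edgeLike_ge_of_character (c : TemperedPiChart ℋ) {e' : ℋ.graph.Edge} {C L₀ : Subgroup c.G}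
    (hL₀ : L₀ ∈ edgeLikeSubgroups c e') {A : Type*} [CommGroup A] (χ : c.G →* A)
    (hsep : ¬ C.map χ ≤ L₀.map χ) :
    ¬ ∃ L ∈ edgeLikeSubgroups c e', C ≤ L := by
  refine not_exists_edgeLike_ge_of_separated c hL₀ χ fun f hf => hsep ?_
  intro x hx
  obtain ⟨y, hy, hyx⟩ := Subgroup.mem_map.mp (hf hx)
  have : y = x := by
    simpa only [MulEquiv.coe_toMonoidHom, MulAut.conj_apply, mul_inv_cancel_comm] using hyx
  exact this ▸ hy

/-- **Separation outside a finite set ⇒ finitely many hostable edges.**  If every edge outside a finite set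
`E₀` carries an edge-like `L₀` and a homomorphism `ρ` to some group separating `C` from `L₀` (no conjugate of
`ρ(L₀)` contains `ρ(C)`), then the `C`-hostable edges lie in `E₀`. [cite: MochizukiSemiAnbd2006, Thm 3.7(iii) p.41] -/
theorem finite_hostable_of_separated (c : TemperedPiChart ℋ) (C : Subgroup c.G) {E₀ : Set ℋ.graph.Edge}
    (hE₀ : E₀.Finite)
    (hsep : ∀ e' ∉ E₀, ∃ L₀ ∈ edgeLikeSubgroups c e', ∃ (F : Type u) (_ : Group F) (ρ : c.G →* F),
      ∀ f : F, ¬ C.map ρ ≤ (L₀.map ρ).map (MulAut.conj f).toMonoidHom) :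
    {e' : ℋ.graph.Edge | ∃ L ∈ edgeLikeSubgroups c e', C ≤ L}.Finite := by
  refine hE₀.subset fun e' he' => ?_
  by_contra hmem
  obtain ⟨L₀, hL₀, F, _, ρ, hρ⟩ := hsep e' hmem
  exact not_exists_edgeLike_ge_of_separated c hL₀ ρ hρ he'

/-- **The centraliser lies in every verticial host when all but finitely many edges are separated from `C` by
some quotient** (`finite_hostable_of_separated` + `centralizer_le_verticial_of_finite_hostable`).
[cite: MochizukiSemiAnbd2006, Thm 3.7(iii) pp.40-41] -/
theorem centralizer_le_verticial_of_separated (h37 : ℋ.Thm37Hypotheses) (c : TemperedPiChart ℋ)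
    (C : Subgroup c.G) (hCc : IsCompact (C : Set c.G)) (hC : C ≠ ⊥) {E₀ : Set ℋ.graph.Edge} (hE₀ : E₀.Finite)
    (hsep : ∀ e' ∉ E₀, ∃ L₀ ∈ edgeLikeSubgroups c e', ∃ (F : Type u) (_ : Group F) (ρ : c.G →* F),
      ∀ f : F, ¬ C.map ρ ≤ (L₀.map ρ).map (MulAut.conj f).toMonoidHom)
    {v : ℋ.graph.Vertex} {H : Subgroup c.G} (hH : H ∈ verticialSubgroups c v) (hCH : C ≤ H) :
    Subgroup.centralizer (C : Set c.G) ≤ H :=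
  centralizer_le_verticial_of_finite_hostable h37 c C hCc hC (finite_hostable_of_separated c C hE₀ hsep) hH hCH

/-! ### Shrinkage: criteria need only small open subgroups -/

/-- **SHRINKAGE.**  If for every open `U ≤ Π_e` some open `U′ ≤ U` has the property that the centraliser of
`ψ(U′)` lies in every verticial subgroup containing `ψ(U′)`, then `EdgeLikeCentralizerAt ℋ c`: centralisers are
antitone and `ψ(U′) ≤ ψ(U)`.  Hence every class criterion for (R3c) need only be verified on a cofinal family of
(small) open subgroups of each edge group. [cite: MochizukiSemiAnbd2006, Cor 3.9 p.43] -/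
theorem edgeLikeCentralizerAt_of_forall_exists_open_le (c : TemperedPiChart ℋ)
    (h : ∀ (e : ℋ.graph.Edge) (ψ : ℋ.Ge e →ₜ* c.G), IsEdgeHom c e ψ →
      ∀ (U : Subgroup (ℋ.Ge e)), IsOpen (U : Set (ℋ.Ge e)) →
      ∃ U' : Subgroup (ℋ.Ge e), U' ≤ U ∧ IsOpen (U' : Set (ℋ.Ge e)) ∧
        ∀ (v : ℋ.graph.Vertex) (H : Subgroup c.G), H ∈ verticialSubgroups c v →
          U'.map ψ.toMonoidHom ≤ H →
            Subgroup.centralizer ((U'.map ψ.toMonoidHom : Subgroup c.G) : Set c.G) ≤ H) :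
    EdgeLikeCentralizerAt ℋ c := by
  intro e ψ hψ U hU v H hH hUH
  obtain ⟨U', hU'U, -, hU'⟩ := h e ψ hψ U hU
  have hle : U'.map ψ.toMonoidHom ≤ U.map ψ.toMonoidHom := Subgroup.map_mono hU'U
  exact (Subgroup.centralizer_le (show ((U'.map ψ.toMonoidHom : Subgroup c.G) : Set c.G) ⊆
      ((U.map ψ.toMonoidHom : Subgroup c.G) : Set c.G) from hle)).trans (hU' v H hH (hle.trans hUH))

/-- **(R3c) from finitely many hostable edges for SMALL open pieces only**: if every open `U ≤ Π_e` contains an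
open `U′` whose piece `ψ(U′)` has finitely many hostable edges, then `EdgeLikeCentralizerAt ℋ c`
(`edgeLikeCentralizerAt_of_forall_exists_open_le` over `centralizer_le_verticial_of_finite_hostable`).
[cite: MochizukiSemiAnbd2006, Cor 3.9 p.43] -/
theorem edgeLikeCentralizerAt_of_finite_hostable_small (hℋ : Cor39Hypotheses ℋ) (c : TemperedPiChart ℋ)
    (hfin : ∀ (e : ℋ.graph.Edge) (ψ : ℋ.Ge e →ₜ* c.G), IsEdgeHom c e ψ →
      ∀ (U : Subgroup (ℋ.Ge e)), IsOpen (U : Set (ℋ.Ge e)) →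
      ∃ U' : Subgroup (ℋ.Ge e), U' ≤ U ∧ IsOpen (U' : Set (ℋ.Ge e)) ∧
        {e' : ℋ.graph.Edge | ∃ L ∈ edgeLikeSubgroups c e', U'.map ψ.toMonoidHom ≤ L}.Finite) :
    EdgeLikeCentralizerAt ℋ c := by
  refine edgeLikeCentralizerAt_of_forall_exists_open_le c fun e ψ hψ U hU => ?_
  obtain ⟨U', hU'U, hU', hfin'⟩ := hfin e ψ hψ U hU
  obtain ⟨hCc, hC⟩ := isCompact_map_and_ne_bot_of_isEdgeHom hℋ c e ψ hψ U' hU'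
  exact ⟨U', hU'U, hU', fun v H hH hU'H =>
    centralizer_le_verticial_of_finite_hostable hℋ.thm37Hypotheses c _ hCc hC hfin' hH hU'H⟩

end ProfiniteSemiGraph

end Literature.AnabelianGeometry.SemiGraphs
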